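import Literature.NumberTheory.EllipticCurves.PAdicHeightsProofs
import Literature.NumberTheory.EllipticCurves.Rank1Residual.Predicates
import Literature.NumberTheory.EllipticCurves.IsogenyHasCMIffJMemProofs
import HarnessLib

/-!
# The `2`-adic valuation of `j` decides «additive and potentially good at `2`»: `1 ≤ v₂(j) ≤ 11`

Topic `NumberTheory/EllipticCurves`; THEOREMS ONLY (no definition, no named fact, no `sorry`). Companion of
`KubertTateNineBadPrimes` §1 (`norm_j_le_one_of_hasGoodReductionAtPrime`: good reduction at `p` forces `‖j‖_p ≤ 1`) and of
`PAdicHeightsProofs.one_lt_norm_j_of_hasMultiplicativeReductionAtPrime` (multiplicative reduction forces `‖j‖_p > 1`),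
SHARPENED AT `p = 2`:

* §1 `norm_c₄_eq_one_or_le_of_padicInt_two`: for EVERY Weierstrass equation with coefficients in `ℤ₂`, `c₄` is either a
  `2`-adic unit or divisible by `16` (`c₄ = b₂² − 24 b₄ ≡ a₁⁴ (mod 2)`; if `2 ∣ a₁` then `4 ∣ b₂`, `2 ∣ b₄`, so `16 ∣ c₄`).
* §2 `padicValRat_j_eq_zero_or_twelve_le_of_hasGoodReductionAtPrime_two`: **good reduction at `2` forces
  `v₂(j) = 0` or `v₂(j) ≥ 12`** (the `ℤ₂`-minimal model has unit `Δ` and integral `c₄`, `j = c₄³/Δ`); hence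
  `addv_two_of_padicValRat_j` : **`1 ≤ v₂(j(E)) ≤ 11 ⟹ E` is ADDITIVE at `2`** (and potentially good, `0 ≤ v₂ j`) — for ANY
  model of `E/ℚ`, the predicate `Rank1Residual.Addv W 2` being read on the `ℤ₂`-minimal model.
* §3 `not_hasCM_of_padicValRat_two_j_mem`: **`v₂(j) ∈ {1, 2, 5, 7, 8, 9, 10, 11} ⟹ E` has no CM** (the thirteen rational CM
  `j`-invariants have `v₂ ∈ {0, 3, 4, 6, 15, 18}` or `j = 0`; tree theorem `hasCM_iff_j_mem_holds`).

So a single rational number, `v₂(j)`, certifies three of the five scope conditions of the K4 additive cruxes at `2`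
(`Addv W 2`, `0 ≤ ord₂ j`, `¬ HasCM`) for every curve in the window — no minimal model, no Tate algorithm. Used by the
`bsd-2adic` cell (crux C1″ `FineSelmerConjAAtTwoAdditivePotGood`: realization of cubic fields as `2`-torsion point fields of
scope curves).

References: [SilvermanAEC2009] III.§1 (the quantities `b₂, b₄, c₄`, `1728 Δ = c₄³ − c₆²`), VII.1.1, Prop. VII.5.1,
Prop. VII.5.5, App. C §11; [Kraus1989] Prop. 2 (the `2`-adic congruences on `c₄`).
-/

noncomputable section

open scoped Classical

namespace WeierstrassCurve

open IsDedekindDomain Literature.NumberTheory.EllipticCurves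

/-! ### §1 Integral equations over `ℤ₂`: `c₄` is a unit or divisible by `16` -/

/-- For a Weierstrass equation with coefficients in `ℤ₂`: `c₄ = a₁⁴ + 2·(4a₁²a₂ + 8a₂² − 24a₄ − 12a₁a₃)` (private copy at
`ℤ₂` of the tree's `c₄_eq_a₁_pow_four_add_two_mul`, `TateCurve/MultiplicativeTwistUnramifiedProofs`, not imported here).
[cite: SilvermanAEC2009, III.§1] -/
private theorem c₄_eq_a₁_pow_four_add_two_mul₂ (M : WeierstrassCurve ℤ_[2]) :
    M.c₄ = M.a₁ ^ 4 + 2 * (4 * M.a₁ ^ 2 * M.a₂ + 8 * M.a₂ ^ 2 - 24 * M.a₄ - 12 * M.a₁ * M.a₃) := by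
  simp only [c₄, b₂, b₄]; ring

/-- For a Weierstrass equation with coefficients in `ℤ₂` and `a₁ = 2c`: `c₄ = 16·((c² + a₂)² − 3(a₄ + c a₃))`.
[cite: SilvermanAEC2009, III.§1] -/
theorem c₄_eq_sixteen_mul_of_a₁_eq_two_mul (M : WeierstrassCurve ℤ_[2]) {c : ℤ_[2]} (hc : M.a₁ = 2 * c) :
    M.c₄ = 16 * ((c ^ 2 + M.a₂) ^ 2 - 3 * (M.a₄ + c * M.a₃)) := by
  simp only [c₄, b₂, b₄, hc]; ring

/-- **`c₄` of a `ℤ₂`-integral Weierstrass equation is a `2`-adic unit or divisible by `16`**: `‖c₄‖₂ = 1` or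
`‖c₄‖₂ ≤ 2⁻⁴` (if `a₁` is odd then `c₄ ≡ a₁⁴` is odd; if `a₁ = 2c` then `c₄ = 16·(…)`). [cite: Kraus1989, Prop. 2]
[cite: SilvermanAEC2009, III.§1] -/
theorem norm_c₄_eq_one_or_le_of_padicInt_two (M : WeierstrassCurve ℤ_[2]) :
    ‖M.c₄‖ = 1 ∨ ‖M.c₄‖ ≤ (2 : ℝ) ^ (-4 : ℤ) := by
  haveI : Fact (Nat.Prime 2) := ⟨Nat.prime_two⟩
  by_cases h1 : (2 : ℤ_[2]) ∣ M.a₁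
  · obtain ⟨c, hc⟩ := h1
    right
    have h16 : M.c₄ ∈ Ideal.span {((2 : ℕ) : ℤ_[2]) ^ 4} := by
      rw [Ideal.mem_span_singleton, c₄_eq_sixteen_mul_of_a₁_eq_two_mul M hc]
      exact ⟨(c ^ 2 + M.a₂) ^ 2 - 3 * (M.a₄ + c * M.a₃), by push_cast; ring⟩
    have := (PadicInt.norm_le_pow_iff_mem_span_pow M.c₄ 4).mpr h16
    exact_mod_cast this
  · left
    have hndvd : ¬ (2 : ℤ_[2]) ∣ M.c₄ := by
      intro h
      rw [c₄_eq_a₁_pow_four_add_two_mul₂] at h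
      have h' : (2 : ℤ_[2]) ∣ M.a₁ ^ 4 := by
        have := dvd_sub h (dvd_mul_right (2 : ℤ_[2])
          (4 * M.a₁ ^ 2 * M.a₂ + 8 * M.a₂ ^ 2 - 24 * M.a₄ - 12 * M.a₁ * M.a₃))
        simpa using this
      exact h1 (PadicInt.prime_p.dvd_of_dvd_pow (by exact_mod_cast h'))
    have hlt : ¬ ‖M.c₄‖ < 1 := fun h => hndvd (by exact_mod_cast (PadicInt.norm_lt_one_iff_dvd M.c₄).mp h)
    exact le_antisymm (PadicInt.norm_le_one _) (not_lt.mp hlt)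

/-! ### §2 Good reduction at `2` forces `v₂(j) ∈ {0} ∪ [12, ∞)`; hence `1 ≤ v₂(j) ≤ 11` forces additive reduction -/

variable (W : WeierstrassCurve ℚ) [W.IsElliptic]

/-- **Good reduction at `2` forces `‖j‖₂ = 1` or `‖j‖₂ ≤ 2⁻¹²`**: on the `ℤ₂`-minimal model `Δ` is a unit, `c₄` is integral
— so a unit or divisible by `16` (§1) — and `j = c₄³/Δ`. [cite: SilvermanAEC2009, Prop. VII.5.1 (a)] [cite: Kraus1989, Prop. 2] -/
theorem norm_j_eq_one_or_le_of_hasGoodReductionAtPrime_two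
    (h : haveI : Fact (Nat.Prime 2) := ⟨Nat.prime_two⟩; W.HasGoodReductionAtPrime 2) :
    haveI : Fact (Nat.Prime 2) := ⟨Nat.prime_two⟩
    ‖(W.j : ℚ_[2])‖ = 1 ∨ ‖(W.j : ℚ_[2])‖ ≤ (2 : ℝ) ^ (-12 : ℤ) := by
  haveI : Fact (Nat.Prime 2) := ⟨Nat.prime_two⟩
  set W' : WeierstrassCurve ℚ_[2] := W.baseChange ℚ_[2] with hW'
  set Wm : WeierstrassCurve ℚ_[2] := W'.minimal ℤ_[2] with hWm
  have hgood : Wm.HasGoodReduction ℤ_[2] := h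
  haveI : IsMinimal ℤ_[2] Wm := hgood.toIsMinimal
  set rc : ℤ_[2] := (integralModel ℤ_[2] Wm).c₄ with hrc_def
  have hrc : (rc : ℚ_[2]) = Wm.c₄ := integralModel_c₄_eq ℤ_[2] Wm
  obtain ⟨rΔ, hrΔ⟩ : ∃ r : ℤ_[2], (r : ℚ_[2]) = Wm.Δ := ⟨_, integralModel_Δ_eq ℤ_[2] Wm⟩
  have hΔ1 := hgood.goodReduction
  rw [← hrΔ, ← PadicInt.algebraMap_apply, HeightOneSpectrum.valuation_eq_one_iff_notMem] at hΔ1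
  change rΔ ∉ IsLocalRing.maximalIdeal ℤ_[2] at hΔ1
  rw [IsLocalRing.mem_maximalIdeal, PadicInt.mem_nonunits] at hΔ1
  have hΔ1' : ‖rΔ‖ = 1 := le_antisymm (PadicInt.norm_le_one _) (not_lt.mp hΔ1)
  have hΔ0 : W.Δ ≠ 0 := W.isUnit_Δ.ne_zero
  have hj : (W.j : ℚ_[2]) = Wm.c₄ ^ 3 / Wm.Δ := by
    have h1 : W.j = W.c₄ ^ 3 / W.Δ := by
      rw [j, ← coe_Δ', Units.val_inv_eq_inv_val]; ring
    rw [hWm, WeierstrassCurve.minimal, variableChange_c₄, variableChange_Δ, hW', h1]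
    simp only [baseChange, map_c₄, map_Δ, eq_ratCast]
    set u : ℚ_[2]ˣ := ((W.baseChange ℚ_[2]).exists_isMinimal ℤ_[2]).choose.u⁻¹
    have hΔ0' : (algebraMap ℚ ℚ_[2]) W.Δ ≠ 0 := by simpa using hΔ0
    have hu : (u : ℚ_[2]) ≠ 0 := u.ne_zero
    push_cast
    field_simp
  rw [hj, ← hrc, ← hrΔ, norm_div, norm_pow, ← PadicInt.norm_def, ← PadicInt.norm_def, hΔ1', div_one]
  rcases norm_c₄_eq_one_or_le_of_padicInt_two (integralModel ℤ_[2] Wm) with h1 | h16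
  · left; rw [← hrc_def] at h1; rw [h1, one_pow]
  · right
    rw [← hrc_def] at h16
    calc ‖rc‖ ^ 3 ≤ ((2 : ℝ) ^ (-4 : ℤ)) ^ 3 := by gcongr
      _ = (2 : ℝ) ^ (-12 : ℤ) := by rw [← zpow_natCast, ← zpow_mul]; norm_num

/-- `‖q‖₂ = 2^{−v₂(q)}` for a non-zero rational `q` (Mathlib `padicNormE.eq_padicNorm`, `padicNorm.eq_zpow_of_nonzero`).
[folklore] -/
private theorem norm_ratCast_padic_two_eq_zpow {q : ℚ} (hq : q ≠ 0) :
    haveI : Fact (Nat.Prime 2) := ⟨Nat.prime_two⟩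
    ‖(q : ℚ_[2])‖ = (2 : ℝ) ^ (-padicValRat 2 q) := by
  haveI : Fact (Nat.Prime 2) := ⟨Nat.prime_two⟩
  rw [Padic.eq_padicNorm, padicNorm.eq_zpow_of_nonzero hq]
  push_cast
  rfl

/-- **Good reduction at `2` forces `v₂(j) = 0` or `v₂(j) ≥ 12`.** (For `j = 0`, `v₂(j) = 0` by convention.)
[cite: SilvermanAEC2009, Prop. VII.5.1 (a)] [cite: Kraus1989, Prop. 2] -/
theorem padicValRat_j_eq_zero_or_twelve_le_of_hasGoodReductionAtPrime_two
    (h : haveI : Fact (Nat.Prime 2) := ⟨Nat.prime_two⟩; W.HasGoodReductionAtPrime 2) :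
    padicValRat 2 W.j = 0 ∨ 12 ≤ padicValRat 2 W.j := by
  haveI : Fact (Nat.Prime 2) := ⟨Nat.prime_two⟩
  by_cases hj0 : W.j = 0
  · left; rw [hj0]; simp
  have hnorm := norm_j_eq_one_or_le_of_hasGoodReductionAtPrime_two W h
  rw [norm_ratCast_padic_two_eq_zpow hj0] at hnorm
  rcases hnorm with h1 | h12
  · left
    have : (-padicValRat 2 W.j) = 0 := by
      have h1' : (2 : ℝ) ^ (-padicValRat 2 W.j) = (2 : ℝ) ^ (0 : ℤ) := by rw [h1, zpow_zero]
      exact zpow_right_injective₀ (by norm_num) (by norm_num) h1'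
    linarith
  · right
    have := (zpow_le_zpow_iff_right₀ (by norm_num : (1 : ℝ) < 2)).mp h12
    linarith

/-- **`1 ≤ v₂(j(E)) ≤ 11 ⟹ E/ℚ` is ADDITIVE at `2`** (`Rank1Residual.Addv W 2`: the `ℤ₂`-minimal model is neither good —
`v₂ j ∉ {0} ∪ [12,∞)` — nor multiplicative — `v₂ j ≥ 0`, whereas multiplicative reduction forces `‖j‖₂ > 1`), for ANY
model `W` of `E`. [cite: SilvermanAEC2009, Prop. VII.5.1 and Prop. VII.5.5] [cite: Kraus1989, Prop. 2] -/
theorem addv_two_of_padicValRat_j (h1 : 1 ≤ padicValRat 2 W.j) (h11 : padicValRat 2 W.j ≤ 11) :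
    haveI : Fact (Nat.Prime 2) := ⟨Nat.prime_two⟩
    Rank1Residual.Addv W 2 := by
  haveI : Fact (Nat.Prime 2) := ⟨Nat.prime_two⟩
  refine ⟨fun hg => ?_, fun hm => ?_⟩
  · rcases padicValRat_j_eq_zero_or_twelve_le_of_hasGoodReductionAtPrime_two W hg with h0 | h12
    · linarith
    · linarith
  · have hlt := one_lt_norm_j_of_hasMultiplicativeReductionAtPrime hm
    have hj0 : W.j ≠ 0 := by
      intro h0; rw [h0] at hlt; norm_num at hlt
    rw [norm_ratCast_padic_two_eq_zpow hj0] at hlt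
    have := (one_lt_zpow_iff_right₀ (by norm_num : (1 : ℝ) < 2)).mp hlt
    linarith

/-- `1 ≤ v₂(j) ≤ 11 ⟹` additive AND potentially good at `2` (`0 ≤ ord₂ j`), the two local scope conditions of the K4
additive potentially-good cruxes at `2`. [cite: SilvermanAEC2009, Prop. VII.5.5] -/
theorem addv_two_and_padicValRat_j_nonneg (h1 : 1 ≤ padicValRat 2 W.j) (h11 : padicValRat 2 W.j ≤ 11) :
    haveI : Fact (Nat.Prime 2) := ⟨Nat.prime_two⟩
    Rank1Residual.Addv W 2 ∧ 0 ≤ padicValRat 2 W.j :=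
  ⟨addv_two_of_padicValRat_j W h1 h11, le_trans (by norm_num) h1⟩

/-! ### §3 The window `v₂(j) ∈ {1, 2, 5, 7, 8, 9, 10, 11}` excludes complex multiplication -/

/-- `v₂(± 2^k · m) = k` for odd `m`. [folklore] -/
private theorem padicValRat_two_pow_mul_odd (k : ℕ) {m : ℕ} (hm : ¬ 2 ∣ m) :
    padicValRat 2 ((2 : ℚ) ^ k * m) = k ∧ padicValRat 2 (-((2 : ℚ) ^ k * m)) = k := by
  haveI : Fact (Nat.Prime 2) := ⟨Nat.prime_two⟩
  have hm0 : (m : ℚ) ≠ 0 := by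
    intro h; apply hm; have : m = 0 := by exact_mod_cast h
    simp [this]
  have h2k : (2 : ℚ) ^ k ≠ 0 := pow_ne_zero _ two_ne_zero
  have hv : padicValRat 2 ((2 : ℚ) ^ k * m) = k := by
    have hself : padicValRat 2 (2 : ℚ) = 1 := by exact_mod_cast padicValRat.self (p := 2) (by norm_num)
    rw [padicValRat.mul h2k hm0, padicValRat.pow, hself]
    have : padicValRat 2 (m : ℚ) = 0 := by
      rw [padicValRat.of_nat]
      exact_mod_cast padicValNat.eq_zero_of_not_dvd hm
    rw [this]; ring
  exact ⟨hv, by rw [padicValRat.neg, hv]⟩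

/-- The `2`-adic valuations of the thirteen rational CM `j`-invariants lie outside `{1, 2, 5, 7, 8, 9, 10, 11}`
(`0 ↦ 0`, `1728 = 2⁶·27`, `−3375` odd, `8000 = 2⁶·125`, `−32768 = −2¹⁵`, `54000 = 2⁴·3375`, `287496 = 2³·35937`,
`−884736 = −2¹⁵·27`, `−12288000 = −2¹⁵·375`, `16581375` odd, `−884736000 = −2¹⁸·3375`, `−147197952000 = −2¹⁵·4492125`,
`−262537412640768000 = −2¹⁸·1001500750125`). [cite: SilvermanAEC2009, App. C §11] -/
theorem padicValRat_two_not_mem_window_of_mem_cmJInvariants {j : ℚ} (hj : j ∈ cmJInvariants) :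
    padicValRat 2 j ∉ ({1, 2, 5, 7, 8, 9, 10, 11} : Finset ℤ) := by
  have e1728 : (1728 : ℚ) = (2 : ℚ) ^ 6 * (27 : ℕ) := by norm_num
  have e3375 : (-3375 : ℚ) = -((2 : ℚ) ^ 0 * (3375 : ℕ)) := by norm_num
  have e8000 : (8000 : ℚ) = (2 : ℚ) ^ 6 * (125 : ℕ) := by norm_num
  have e32768 : (-32768 : ℚ) = -((2 : ℚ) ^ 15 * (1 : ℕ)) := by norm_num
  have e54000 : (54000 : ℚ) = (2 : ℚ) ^ 4 * (3375 : ℕ) := by norm_num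
  have e287496 : (287496 : ℚ) = (2 : ℚ) ^ 3 * (35937 : ℕ) := by norm_num
  have e884736 : (-884736 : ℚ) = -((2 : ℚ) ^ 15 * (27 : ℕ)) := by norm_num
  have e12288000 : (-12288000 : ℚ) = -((2 : ℚ) ^ 15 * (375 : ℕ)) := by norm_num
  have e16581375 : (16581375 : ℚ) = (2 : ℚ) ^ 0 * (16581375 : ℕ) := by norm_num
  have e884736000 : (-884736000 : ℚ) = -((2 : ℚ) ^ 18 * (3375 : ℕ)) := by norm_num
  have e147 : (-147197952000 : ℚ) = -((2 : ℚ) ^ 15 * (4492125 : ℕ)) := by norm_num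
  have e262 : (-262537412640768000 : ℚ) = -((2 : ℚ) ^ 18 * (1001500750125 : ℕ)) := by norm_num
  simp only [cmJInvariants, Finset.mem_insert, Finset.mem_singleton] at hj
  rcases hj with rfl | rfl | rfl | rfl | rfl | rfl | rfl | rfl | rfl | rfl | rfl | rfl | rfl
  · simp
  · rw [e1728, (padicValRat_two_pow_mul_odd 6 (by norm_num)).1]; decide
  · rw [e3375, (padicValRat_two_pow_mul_odd 0 (by norm_num)).2]; decide
  · rw [e8000, (padicValRat_two_pow_mul_odd 6 (by norm_num)).1]; decide
  · rw [e32768, (padicValRat_two_pow_mul_odd 15 (by norm_num)).2]; decide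
  · rw [e54000, (padicValRat_two_pow_mul_odd 4 (by norm_num)).1]; decide
  · rw [e287496, (padicValRat_two_pow_mul_odd 3 (by norm_num)).1]; decide
  · rw [e884736, (padicValRat_two_pow_mul_odd 15 (by norm_num)).2]; decide
  · rw [e12288000, (padicValRat_two_pow_mul_odd 15 (by norm_num)).2]; decide
  · rw [e16581375, (padicValRat_two_pow_mul_odd 0 (by norm_num)).1]; decide
  · rw [e884736000, (padicValRat_two_pow_mul_odd 18 (by norm_num)).2]; decide
  · rw [e147, (padicValRat_two_pow_mul_odd 15 (by norm_num)).2]; decide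
  · rw [e262, (padicValRat_two_pow_mul_odd 18 (by norm_num)).2]; decide

/-- **`v₂(j(E)) ∈ {1, 2, 5, 7, 8, 9, 10, 11} ⟹ E/ℚ` has no complex multiplication** (tree theorem
`hasCM_iff_j_mem_holds`: CM over `ℚ` ⟺ `j` is one of the thirteen class-number-one values, whose `2`-adic valuations are
`0, 3, 4, 6, 15, 18`). [cite: SilvermanAEC2009, App. C §11] -/
theorem not_hasCM_of_padicValRat_two_j_mem
    (h : padicValRat 2 W.j ∈ ({1, 2, 5, 7, 8, 9, 10, 11} : Finset ℤ)) : ¬ W.HasCM := fun hcm =>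
  padicValRat_two_not_mem_window_of_mem_cmJInvariants ((hasCM_iff_j_mem_holds W).mp hcm) h

/-- **The window, all at once**: `v₂(j(E)) ∈ {1, 2, 5, 7, 8, 9, 10, 11} ⟹ E` is non-CM, additive at `2` and potentially
good at `2` — three of the five scope binders of the K4 additive potentially-good cruxes at `2`, for any model `W`.
[cite: SilvermanAEC2009, Prop. VII.5.1, Prop. VII.5.5 and App. C §11] [cite: Kraus1989, Prop. 2] -/
theorem not_hasCM_and_addv_two_of_padicValRat_two_j_mem
    (h : padicValRat 2 W.j ∈ ({1, 2, 5, 7, 8, 9, 10, 11} : Finset ℤ)) :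
    haveI : Fact (Nat.Prime 2) := ⟨Nat.prime_two⟩
    ¬ W.HasCM ∧ Rank1Residual.Addv W 2 ∧ 0 ≤ padicValRat 2 W.j := by
  have h1 : 1 ≤ padicValRat 2 W.j := by
    simp only [Finset.mem_insert, Finset.mem_singleton] at h; omega
  have h11 : padicValRat 2 W.j ≤ 11 := by
    simp only [Finset.mem_insert, Finset.mem_singleton] at h; omega
  exact ⟨not_hasCM_of_padicValRat_two_j_mem W h, addv_two_and_padicValRat_j_nonneg W h1 h11⟩

end WeierstrassCurve

end
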